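import Literature.AlgebraicGeometry.HodgeTheory.FermatHodgeCharacterQuad
import HarnessLib

/-!
# Four unit points annihilated by the odd primitive characters (Aoki 1983, Prop. 8.2)

Support file XII (everything PROVED; no named facts, no definitions) for the structure theorem of
the Hodge characters of the Fermat surface (`AokiShioda1983_thmB2m_standard`).

`quad_odd_top`: at a level `f = q · n` (`q = p^e` a prime power whose kernel
`ker((ℤ/q)ˣ → (ℤ/p^(e-1))ˣ)` leaves every `±`-residue class of the four points free — e.g.
`p ≥ 11`, or `p ≥ 5` with `e ≥ 2`), four units `xᵢ` with `∑ χ(xᵢ) = 0` for every ODD primitive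
character `χ` mod `f` either SPLIT (`χ(xᵢ) + χ(xⱼ) = 0` and `χ(xₖ) + χ(xₗ) = 0` for all such
`χ`), or `5 ∥ f` and `χ(xᵢ mod f/5)` is independent of `i` for every odd primitive `χ` mod
`f/5` (Aoki's "`5`-quasi-standard" case: `xᵢ ≡ kᵢ x₀ (mod f/5)` with `kᵢ ∈ U(f/5)`).
The first peel is done in the odd world with the local Fourier lemma; the slice is then a signed
four-term configuration annihilated by ALL primitive characters mod `n`, to which the recursion
`quad_allprim` (file `Quad`) applies. [cite: Aoki1983, Prop. 8.2; (I-1) of §9]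

## References

* [Aoki1983] N. Aoki, On some arithmetic problems related to the Hodge cycles on the Fermat
  varieties, Math. Ann. 266 (1983) 23–54, Prop. 8.2 and §9 (I-1) (text read).
-/

noncomputable section

open Finset

namespace Literature.AlgebraicGeometry.HodgeTheory

namespace FermatCharacter

section Top

variable {q n : ℕ} [NeZero q] [NeZero n]

/-- **The odd-world slice relation.** For four units with `∑ χ(xᵢ) = 0` for all odd primitive
`χ` mod `q n`, a unit residue `y` mod `q` whose `±`-class is free, and a primitive `χ'` mod `n`:
`∑_{xᵢ ≡ y} χ'(xᵢ) - χ'(-1) ∑_{xᵢ ≡ -y} χ'(xᵢ) = 0`. [cite: Aoki1983, Lemma 3.2] -/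
theorem odd_slice_rel (h : q.Coprime n) {d : ℕ} (hd : d ∣ q)
    (hprim : ∀ χ : DirichletCharacter ℂ q, ¬ χ.FactorsThrough d → χ.IsPrimitive)
    (x : Fin 4 → (ZMod (q * n))ˣ)
    (hT : ∀ χ : DirichletCharacter ℂ (q * n), χ.Odd → χ.IsPrimitive → ∑ i, χ (x i) = 0)
    (y u : (ZMod q)ˣ) (hu : ZMod.unitsMap hd u = 1)
    (hfree : ∀ i, ZMod.castHom (dvd_mul_right q n) (ZMod q) (x i) ≠ (u : ZMod q) * y ∧
      ZMod.castHom (dvd_mul_right q n) (ZMod q) (x i) ≠ -((u : ZMod q) * y))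
    (χ' : DirichletCharacter ℂ n) (hχ' : χ'.IsPrimitive) :
    (∑ i, (if ZMod.castHom (dvd_mul_right q n) (ZMod q) (x i) = y then
        χ' (ZMod.castHom (dvd_mul_left n q) (ZMod n) (x i)) else 0)) -
      χ' (-1) * ∑ i, (if ZMod.castHom (dvd_mul_right q n) (ZMod q) (x i) = -(y : ZMod q) then
        χ' (ZMod.castHom (dvd_mul_left n q) (ZMod n) (x i)) else 0) = 0 := by
  classical
  haveI : NeZero (q * n) := ⟨mul_ne_zero (NeZero.ne q) (NeZero.ne n)⟩
  set F : ZMod q → ℂ := fun ρ ↦ ∑ i, (if ZMod.castHom (dvd_mul_right q n) (ZMod q) (x i) = ρ then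
      χ' (ZMod.castHom (dvd_mul_left n q) (ZMod n) (x i)) else 0) with hF
  have hη2 : χ' (-1) * χ' (-1) = 1 := by rw [← map_mul, neg_one_mul, neg_neg, map_one]
  have hε : -χ' (-1) = 1 ∨ -χ' (-1) = -1 := by
    rcases χ'.even_or_odd with he | ho
    · right; rw [he]
    · left; rw [ho]; norm_num
  have horth : ∀ χ₁ : DirichletCharacter ℂ q, χ₁ (-1) = -χ' (-1) → ¬ χ₁.FactorsThrough d →
      ∑ ρ : ZMod q, F ρ * χ₁ ρ = 0 := by
    intro χ₁ hpar hχ₁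
    have hodd : (DirichletCharacter.changeLevel (dvd_mul_right q n) χ₁ *
        DirichletCharacter.changeLevel (dvd_mul_left n q) χ').Odd := by
      rw [DirichletCharacter.Odd, prodChar_neg_one, hpar]
      linear_combination -hη2
    have key := hT _ hodd (prodChar_isPrimitive h (hprim χ₁ hχ₁) hχ')
    simp_rw [prodChar_apply] at key
    have hcomm : ∑ ρ : ZMod q, F ρ * χ₁ ρ = ∑ i, χ₁ (ZMod.castHom (dvd_mul_right q n) (ZMod q) (x i)) *
        χ' (ZMod.castHom (dvd_mul_left n q) (ZMod n) (x i)) := by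
      simp only [hF, Finset.sum_mul]
      rw [Finset.sum_comm]
      refine Finset.sum_congr rfl fun i _ ↦ ?_
      rw [Finset.sum_eq_single_of_mem (ZMod.castHom (dvd_mul_right q n) (ZMod q) (x i)) (mem_univ _)
        (fun ρ _ hρ ↦ by rw [if_neg (Ne.symm hρ), zero_mul]), if_pos rfl]
      ring
    rw [hcomm]
    exact key
  have key := parityPart_mul_eq_of_orthogonal hd F hε horth u y hu
  have h1 : F ((u : ZMod q) * y) = 0 :=
    Finset.sum_eq_zero fun i _ ↦ if_neg (hfree i).1
  have h2 : F (-((u : ZMod q) * y)) = 0 :=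
    Finset.sum_eq_zero fun i _ ↦ if_neg (hfree i).2
  rw [h1, h2, mul_zero, add_zero] at key
  linear_combination -key

omit [NeZero q] in
/-- An index whose `±`-class mod `q` contains no other point is contradictory.
[cite: Aoki1983, Prop. 8.2] -/
theorem odd_false_of_alone [Fact (1 < q)] (h : q.Coprime n) {d : ℕ} (hd : d ∣ q)
    (hprim : ∀ χ : DirichletCharacter ℂ q, ¬ χ.FactorsThrough d → χ.IsPrimitive)
    (hq : IsUnit (2 : ZMod q)) (hn : Odd n ∨ 4 ∣ n) (x : Fin 4 → (ZMod (q * n))ˣ)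
    (hT : ∀ χ : DirichletCharacter ℂ (q * n), χ.Odd → χ.IsPrimitive → ∑ i, χ (x i) = 0)
    (hfreeAll : ∀ y : (ZMod q)ˣ, ∃ u : (ZMod q)ˣ, ZMod.unitsMap hd u = 1 ∧
      ∀ i, ZMod.castHom (dvd_mul_right q n) (ZMod q) (x i) ≠ (u : ZMod q) * y ∧
        ZMod.castHom (dvd_mul_right q n) (ZMod q) (x i) ≠ -((u : ZMod q) * y))
    (a : Fin 4) (halone : ∀ j, j ≠ a →
      ZMod.castHom (dvd_mul_right q n) (ZMod q) (x j) ≠ ZMod.castHom (dvd_mul_right q n) (ZMod q) (x a) ∧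
      ZMod.castHom (dvd_mul_right q n) (ZMod q) (x j) ≠ -ZMod.castHom (dvd_mul_right q n) (ZMod q) (x a)) :
    False := by
  classical
  obtain ⟨χ', hχ'⟩ := exists_isPrimitive (n := n) hn
  obtain ⟨u, hu, hfu⟩ := hfreeAll (ZMod.unitsMap (dvd_mul_right q n) (x a))
  have rel := odd_slice_rel h hd hprim x hT _ u hu hfu χ' hχ'
  rw [coe_unitsMap] at rel
  have hself : ZMod.castHom (dvd_mul_right q n) (ZMod q) (x a) ≠
      -ZMod.castHom (dvd_mul_right q n) (ZMod q) (x a) := by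
    intro he
    have h2 : (2 : ZMod q) * ZMod.castHom (dvd_mul_right q n) (ZMod q) (x a) = 0 := by
      linear_combination he
    have := ((Units.isUnit (x a)).map (ZMod.castHom (dvd_mul_right q n) (ZMod q)))
    exact (hq.mul this).ne_zero h2
  rw [Finset.sum_eq_single_of_mem a (mem_univ _) (fun j _ hj ↦ if_neg (halone j hj).1), if_pos rfl,
    Finset.sum_eq_zero (fun j _ ↦ ?_), mul_zero, sub_zero] at rel
  · have := DirichletCharacter.unit_norm_eq_one χ' (ZMod.unitsMap (dvd_mul_left n q) (x a))
    rw [coe_unitsMap, rel, norm_zero] at this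
    exact zero_ne_one this
  · by_cases hj : j = a
    · rw [hj, if_neg hself]
    · rw [if_neg (halone j hj).2]

/-- A block `{a, b}` of two points in one `±`-class mod `q` which contains no other point is an
annihilated pair. [cite: Aoki1983, Prop. 8.2] -/
theorem odd_pair_of_block [Fact (1 < q)] (h : q.Coprime n) {d : ℕ} (hd : d ∣ q)
    (hprim : ∀ χ : DirichletCharacter ℂ q, ¬ χ.FactorsThrough d → χ.IsPrimitive)
    (hq : IsUnit (2 : ZMod q)) (x : Fin 4 → (ZMod (q * n))ˣ)
    (hT : ∀ χ : DirichletCharacter ℂ (q * n), χ.Odd → χ.IsPrimitive → ∑ i, χ (x i) = 0)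
    (hfreeAll : ∀ y : (ZMod q)ˣ, ∃ u : (ZMod q)ˣ, ZMod.unitsMap hd u = 1 ∧
      ∀ i, ZMod.castHom (dvd_mul_right q n) (ZMod q) (x i) ≠ (u : ZMod q) * y ∧
        ZMod.castHom (dvd_mul_right q n) (ZMod q) (x i) ≠ -((u : ZMod q) * y))
    (a b : Fin 4) (hab : a ≠ b)
    (hb : ZMod.castHom (dvd_mul_right q n) (ZMod q) (x b) = ZMod.castHom (dvd_mul_right q n) (ZMod q) (x a) ∨
      ZMod.castHom (dvd_mul_right q n) (ZMod q) (x b) = -ZMod.castHom (dvd_mul_right q n) (ZMod q) (x a))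
    (hother : ∀ j, j ≠ a → j ≠ b →
      ZMod.castHom (dvd_mul_right q n) (ZMod q) (x j) ≠ ZMod.castHom (dvd_mul_right q n) (ZMod q) (x a) ∧
      ZMod.castHom (dvd_mul_right q n) (ZMod q) (x j) ≠ -ZMod.castHom (dvd_mul_right q n) (ZMod q) (x a))
    (χ : DirichletCharacter ℂ (q * n)) (hodd : χ.Odd) (hχ : χ.IsPrimitive) : χ (x a) + χ (x b) = 0 := by
  classical
  haveI : NeZero (q * n) := ⟨mul_ne_zero (NeZero.ne q) (NeZero.ne n)⟩
  set ra := ZMod.castHom (dvd_mul_right q n) (ZMod q) (x a) with hra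
  have hrau : IsUnit ra := by rw [hra]; exact (Units.isUnit (x a)).map _
  have hself : ra ≠ -ra := by
    intro he
    have h2 : (2 : ZMod q) * ra = 0 := by linear_combination he
    exact (hq.mul hrau).ne_zero h2
  -- decompose `χ`
  obtain ⟨χ₁, χ', rfl, hp⟩ := exists_eq_prodChar h χ
  obtain ⟨h1, h2⟩ := hp hχ
  have hpar : χ₁ (-1) * χ' (-1) = -1 := by
    have := hodd; rw [DirichletCharacter.Odd, prodChar_neg_one] at this; exact this
  obtain ⟨u, hu, hfu⟩ := hfreeAll (ZMod.unitsMap (dvd_mul_right q n) (x a))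
  have rel := odd_slice_rel h hd hprim x hT _ u hu hfu χ' h2
  rw [coe_unitsMap, ← hra] at rel
  rw [prodChar_apply, prodChar_apply, ← hra]
  rcases hb with hb | hb
  · -- same residue
    rw [Finset.sum_eq_add_of_mem a b (mem_univ _) (mem_univ _) hab (fun j _ hj ↦ if_neg (hother j hj.1 hj.2).1),
      if_pos rfl, if_pos hb, Finset.sum_eq_zero (fun j _ ↦ ?_), mul_zero, sub_zero] at rel
    · rw [hb]; linear_combination χ₁ ra * rel
    · by_cases hja : j = a
      · rw [hja, if_neg hself]
      by_cases hjb : j = b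
      · rw [hjb, if_neg (fun h' ↦ hself (hb.symm.trans h'))]
      rw [if_neg (hother j hja hjb).2]
  · -- opposite residues
    rw [Finset.sum_eq_single_of_mem a (mem_univ _), if_pos rfl,
      Finset.sum_eq_single_of_mem b (mem_univ _), if_pos hb] at rel
    · rw [hb, ← neg_one_mul ra, map_mul]
      have hη2 : χ' (-1) * χ' (-1) = 1 := by rw [← map_mul, neg_one_mul, neg_neg, map_one]
      -- `χ₁(-1) = -χ'(-1)`
      have hq1 : χ₁ (-1) = -χ' (-1) := by linear_combination χ' (-1) * hpar - χ₁ (-1) * hη2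
      linear_combination χ₁ ra * rel +
        (χ₁ ra * χ' (ZMod.castHom (dvd_mul_left n q) (ZMod n) (x b))) * hq1
    · intro j _ hjb
      by_cases hja : j = a
      · rw [hja, if_neg hself]
      rw [if_neg (hother j hja hjb).2]
    · intro j _ hja
      by_cases hjb : j = b
      · rw [hjb, if_neg (fun h' ↦ hself (hb.symm.trans h').symm)]
      rw [if_neg (hother j hja hjb).1]

/-- **[Aoki1983, Prop. 8.2] at a level with a free prime power.** Four units `xᵢ` with
`∑ χ(xᵢ) = 0` for every odd primitive `χ` mod `q n` (every `±`-class mod `q` free, `2` a unit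
mod `q`, `n` odd or `4 ∣ n`) SPLIT into two annihilated pairs, or `5 ∥ n` and `χ(xᵢ mod q n/5)`
is independent of `i` for every odd primitive `χ` mod `q n/5`. [cite: Aoki1983, Prop. 8.2] -/
theorem quad_odd_top [Fact (1 < q)] (h : q.Coprime n) {d : ℕ} (hd : d ∣ q)
    (hprim : ∀ χ : DirichletCharacter ℂ q, ¬ χ.FactorsThrough d → χ.IsPrimitive)
    (hq : IsUnit (2 : ZMod q)) (hn : Odd n ∨ 4 ∣ n) (x : Fin 4 → (ZMod (q * n))ˣ)
    (hT : ∀ χ : DirichletCharacter ℂ (q * n), χ.Odd → χ.IsPrimitive → ∑ i, χ (x i) = 0)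
    (hfreeAll : ∀ y : (ZMod q)ˣ, ∃ u : (ZMod q)ˣ, ZMod.unitsMap hd u = 1 ∧
      ∀ i, ZMod.castHom (dvd_mul_right q n) (ZMod q) (x i) ≠ (u : ZMod q) * y ∧
        ZMod.castHom (dvd_mul_right q n) (ZMod q) (x i) ≠ -((u : ZMod q) * y)) :
    (∃ i j k l : Fin 4, i ≠ j ∧ i ≠ k ∧ i ≠ l ∧ j ≠ k ∧ j ≠ l ∧ k ≠ l ∧
      (∀ χ : DirichletCharacter ℂ (q * n), χ.Odd → χ.IsPrimitive → χ (x i) + χ (x j) = 0) ∧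
      (∀ χ : DirichletCharacter ℂ (q * n), χ.Odd → χ.IsPrimitive → χ (x k) + χ (x l) = 0)) ∨
    (∃ n₅ : ℕ, n = 5 * n₅ ∧ ¬ 5 ∣ n₅ ∧ ∀ (hd5 : q * n₅ ∣ q * n) (χ : DirichletCharacter ℂ (q * n₅)),
      χ.Odd → χ.IsPrimitive → ∀ i j : Fin 4,
        χ (ZMod.castHom hd5 (ZMod (q * n₅)) (x i)) = χ (ZMod.castHom hd5 (ZMod (q * n₅)) (x j))) := by
  classical
  haveI : NeZero (q * n) := ⟨mul_ne_zero (NeZero.ne q) (NeZero.ne n)⟩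
  -- notation
  set r : Fin 4 → ZMod q := fun i ↦ ZMod.castHom (dvd_mul_right q n) (ZMod q) (x i) with hr
  set x' : Fin 4 → (ZMod n)ˣ := fun i ↦ ZMod.unitsMap (dvd_mul_left n q) (x i) with hx'
  have hxval : ∀ i, ZMod.castHom (dvd_mul_left n q) (ZMod n) (x i) = (x' i : ZMod n) :=
    fun i ↦ (coe_unitsMap _ _).symm
  have hru : ∀ i, IsUnit (r i) := fun i ↦ (Units.isUnit (x i)).map _
  have hself : ∀ i, r i ≠ -r i := by
    intro i he
    have h2 : (2 : ZMod q) * r i = 0 := by linear_combination he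
    exact (hq.mul (hru i)).ne_zero h2
  have alone := fun (a : Fin 4) ↦ odd_false_of_alone h hd hprim hq hn x hT hfreeAll a
  have block := fun (a b : Fin 4) ↦ odd_pair_of_block h hd hprim hq x hT hfreeAll a b
  -- `B i j`: `r j = ± r i`
  have hsym : ∀ i j, (r j = r i ∨ r j = -r i) → (r i = r j ∨ r i = -r j) := by
    rintro i j (hj | hj)
    · exact Or.inl hj.symm
    · right; rw [hj, neg_neg]
  have htrans : ∀ i j k, (r j = r i ∨ r j = -r i) → (r k = r i ∨ r k = -r i) →
      (r k = r j ∨ r k = -r j) := by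
    rintro i j k (hj | hj) (hk | hk)
    · exact Or.inl (hk.trans hj.symm)
    · right; rw [hk, hj]
    · right; rw [hk, hj, neg_neg]
    · left; rw [hk, hj]
  have notB : ∀ i j, ¬ (r j = r i ∨ r j = -r i) → ¬ (r i = r j ∨ r i = -r j) :=
    fun i j hn hb ↦ hn (hsym j i hb)
  have sep : ∀ j m, (r j = r 0 ∨ r j = -r 0) → ¬ (r m = r 0 ∨ r m = -r 0) →
      ¬ (r j = r m ∨ r j = -r m) := by
    intro j m hj hm hjm
    exact hm (htrans j 0 m (hsym 0 j hj) (hsym m j hjm))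
  by_cases h1 : r 1 = r 0 ∨ r 1 = -r 0 <;> by_cases h2 : r 2 = r 0 ∨ r 2 = -r 0 <;>
    by_cases h3 : r 3 = r 0 ∨ r 3 = -r 0
  · /- concentrated: all four points are `≡ ± r 0`; pass to the all-primitive configuration of
    avatars `pᵢ = εᵢ xᵢ mod n` with signs `εᵢ` -/
    have hall : ∀ i, r i = r 0 ∨ r i = -r 0 := by
      intro i; fin_cases i
      · exact Or.inl rfl
      · exact h1
      · exact h2
      · exact h3
    set ε : Fin 4 → ℂ := fun i ↦ if r i = r 0 then 1 else -1 with hε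
    set pav : Fin 4 → (ZMod n)ˣ := fun i ↦ if r i = r 0 then x' i else -x' i with hpav
    have hεs : ∀ i, ε i = 1 ∨ ε i = -1 := by
      intro i; simp only [hε]; split_ifs
      · exact Or.inl rfl
      · exact Or.inr rfl
    -- key: `χ'(x'ᵢ) = εᵢ χ'(pᵢ)` for odd `χ'`, `= χ'(pᵢ)`-twisted in general:
    -- `χ'(x'ᵢ) = (if rᵢ = r₀ then 1 else χ'(-1)) * χ'(pᵢ)`
    have hxp : ∀ (χ' : DirichletCharacter ℂ n) (i : Fin 4),
        χ' (x' i : ZMod n) = (if r i = r 0 then 1 else χ' (-1)) * χ' (pav i : ZMod n) := by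
      intro χ' i
      simp only [hpav]
      split_ifs
      · rw [one_mul]
      · rw [Units.val_neg, ← map_mul, neg_one_mul, neg_neg]
    -- the all-primitive relation
    have hnull : ∀ χ' : DirichletCharacter ℂ n, χ'.IsPrimitive →
        ∑ i, ε i * χ' (pav i : ZMod n) = 0 := by
      intro χ' hχ'
      obtain ⟨u, hu, hfu⟩ := hfreeAll (ZMod.unitsMap (dvd_mul_right q n) (x 0))
      have rel := odd_slice_rel h hd hprim x hT _ u hu hfu χ' hχ'
      rw [coe_unitsMap] at rel
      change (∑ i, (if r i = r 0 then χ' (ZMod.castHom (dvd_mul_left n q) (ZMod n) (x i)) else 0)) -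
        χ' (-1) * ∑ i, (if r i = -r 0 then χ' (ZMod.castHom (dvd_mul_left n q) (ZMod n) (x i)) else 0)
          = 0 at rel
      have hη2 : χ' (-1) * χ' (-1) = 1 := by rw [← map_mul, neg_one_mul, neg_neg, map_one]
      rw [Finset.mul_sum, ← Finset.sum_sub_distrib] at rel
      rw [← rel]
      refine Finset.sum_congr rfl fun i _ ↦ ?_
      rw [hxval, hxp χ' i]
      simp only [hε]
      rcases hall i with hi | hi
      · have hne : ¬ r i = -r 0 := fun h' ↦ hself 0 (hi.symm.trans h')
        rw [if_pos hi, if_pos hi, if_pos hi, if_neg hne]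
        ring
      · have hne : ¬ r i = r 0 := fun h' ↦ hself 0 (h'.symm.trans hi)
        rw [if_neg hne, if_neg hne, if_neg hne, if_pos hi]
        linear_combination (χ' (pav i : ZMod n)) * hη2
    -- the term formula for an odd product character
    have hterm : ∀ (χ₁ : DirichletCharacter ℂ q) (χ' : DirichletCharacter ℂ n),
        χ₁ (-1) * χ' (-1) = -1 → ∀ i,
        χ₁ (r i) * χ' (x' i : ZMod n) = χ₁ (r 0) * (ε i * χ' (pav i : ZMod n)) := by
      intro χ₁ χ' hpar i
      rw [hxp χ' i]
      simp only [hε]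
      rcases hall i with hi | hi
      · simp only [hi, if_true, one_mul]
      · have hne : ¬ r i = r 0 := fun h' ↦ hself 0 (h'.symm.trans hi)
        rw [if_neg hne, if_neg hne, hi, ← neg_one_mul (r 0), map_mul]
        linear_combination (χ₁ (r 0) * χ' (pav i : ZMod n)) * hpar
    rcases quad_allprim n (NeZero.ne n) hn pav ε hεs hnull with
      ⟨i, j, k, l, n1, n2, n3, n4, n5, n6, hp1, hp2⟩ | ⟨n₅, hn5, h5, H⟩
    · left
      refine ⟨i, j, k, l, n1, n2, n3, n4, n5, n6, fun χ hodd hχ ↦ ?_, fun χ hodd hχ ↦ ?_⟩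
      · obtain ⟨χ₁, χ', rfl, hp⟩ := exists_eq_prodChar h χ
        obtain ⟨-, h2'⟩ := hp hχ
        have hpar : χ₁ (-1) * χ' (-1) = -1 := by
          have := hodd; rw [DirichletCharacter.Odd, prodChar_neg_one] at this; exact this
        rw [prodChar_apply, prodChar_apply, hxval, hxval]
        change χ₁ (r i) * χ' (x' i : ZMod n) + χ₁ (r j) * χ' (x' j : ZMod n) = 0
        rw [hterm χ₁ χ' hpar i, hterm χ₁ χ' hpar j, ← mul_add, hp1 χ' h2', mul_zero]
      · obtain ⟨χ₁, χ', rfl, hp⟩ := exists_eq_prodChar h χ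
        obtain ⟨-, h2'⟩ := hp hχ
        have hpar : χ₁ (-1) * χ' (-1) = -1 := by
          have := hodd; rw [DirichletCharacter.Odd, prodChar_neg_one] at this; exact this
        rw [prodChar_apply, prodChar_apply, hxval, hxval]
        change χ₁ (r k) * χ' (x' k : ZMod n) + χ₁ (r l) * χ' (x' l : ZMod n) = 0
        rw [hterm χ₁ χ' hpar k, hterm χ₁ χ' hpar l, ← mul_add, hp2 χ' h2', mul_zero]
    · right
      have hn₅0 : n₅ ≠ 0 := fun h0 ↦ NeZero.ne n (by rw [hn5, h0, mul_zero])
      haveI : NeZero n₅ := ⟨hn₅0⟩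
      haveI : NeZero (q * n₅) := ⟨mul_ne_zero (NeZero.ne q) hn₅0⟩
      have hd5 : n₅ ∣ n := ⟨5, by rw [hn5, mul_comm]⟩
      have hcop5 : q.Coprime n₅ := Nat.Coprime.coprime_dvd_right hd5 h
      refine ⟨n₅, hn5, h5, fun hd' χ hodd hχ i j ↦ ?_⟩
      obtain ⟨χ₁, χ₀, rfl, hp⟩ := exists_eq_prodChar hcop5 χ
      obtain ⟨-, h0'⟩ := hp hχ
      have hpar : χ₁ (-1) * χ₀ (-1) = -1 := by
        have := hodd; rw [DirichletCharacter.Odd, prodChar_neg_one] at this; exact this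
      have heval : ∀ i, (DirichletCharacter.changeLevel (dvd_mul_right q n₅) χ₁ *
          DirichletCharacter.changeLevel (dvd_mul_left n₅ q) χ₀) (ZMod.castHom hd' (ZMod (q * n₅)) (x i)) =
          χ₁ (r i) * χ₀ (ZMod.castHom hd5 (ZMod n₅) (x' i : ZMod n)) := by
        intro i
        rw [prodChar_apply, castHom_castHom, castHom_castHom, ← hxval, castHom_castHom]
      -- the term formula for `χ₀ ∘ (mod n₅)`
      have hterm₀ : ∀ i, χ₁ (r i) * χ₀ (ZMod.castHom hd5 (ZMod n₅) (x' i : ZMod n)) =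
          χ₁ (r 0) * (ε i * χ₀ (ZMod.castHom hd5 (ZMod n₅) (pav i : ZMod n))) := by
        intro i
        simp only [hε, hpav]
        rcases hall i with hi | hi
        · simp only [hi, if_true, one_mul]
        · have hne : ¬ r i = r 0 := fun h' ↦ hself 0 (h'.symm.trans hi)
          rw [if_neg hne, if_neg hne, hi, ← neg_one_mul (r 0), map_mul, Units.val_neg,
            map_neg (ZMod.castHom hd5 (ZMod n₅)),
            ← neg_one_mul (ZMod.castHom hd5 (ZMod n₅) (x' i : ZMod n)), map_mul]
          have hη2 : χ₀ (-1) * χ₀ (-1) = 1 := by rw [← map_mul, neg_one_mul, neg_neg, map_one]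
          linear_combination
            (χ₁ (r 0) * χ₀ (ZMod.castHom hd5 (ZMod n₅) (x' i : ZMod n)) * χ₀ (-1)) * hpar -
            (χ₁ (r 0) * χ₀ (ZMod.castHom hd5 (ZMod n₅) (x' i : ZMod n)) * χ₁ (-1)) * hη2
      rw [heval, heval, hterm₀ i, hterm₀ j, H hd5 χ₀ h0' i j]
  · exfalso; refine alone 3 fun j hj ↦ not_or.mp ?_
    fin_cases j
    · exact notB 0 3 h3
    · exact sep 1 3 h1 h3
    · exact sep 2 3 h2 h3
    · exact absurd rfl hj
  · exfalso; refine alone 2 fun j hj ↦ not_or.mp ?_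
    fin_cases j
    · exact notB 0 2 h2
    · exact sep 1 2 h1 h2
    · exact absurd rfl hj
    · exact sep 3 2 h3 h2
  · by_cases h23 : r 3 = r 2 ∨ r 3 = -r 2
    · left
      refine ⟨0, 1, 2, 3, by decide, by decide, by decide, by decide, by decide, by decide,
        block 0 1 (by decide) h1 (fun j hj0 hj1 ↦ not_or.mp ?_),
        block 2 3 (by decide) h23 (fun j hj2 hj3 ↦ not_or.mp ?_)⟩
      · fin_cases j
        · exact absurd rfl hj0
        · exact absurd rfl hj1
        · exact h2
        · exact h3
      · fin_cases j
        · exact notB 0 2 h2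
        · exact sep 1 2 h1 h2
        · exact absurd rfl hj2
        · exact absurd rfl hj3
    · exfalso; refine alone 2 fun j hj ↦ not_or.mp ?_
      fin_cases j
      · exact notB 0 2 h2
      · exact sep 1 2 h1 h2
      · exact absurd rfl hj
      · exact h23
  · exfalso; refine alone 1 fun j hj ↦ not_or.mp ?_
    fin_cases j
    · exact notB 0 1 h1
    · exact absurd rfl hj
    · exact sep 2 1 h2 h1
    · exact sep 3 1 h3 h1
  · by_cases h13 : r 3 = r 1 ∨ r 3 = -r 1
    · left
      refine ⟨0, 2, 1, 3, by decide, by decide, by decide, by decide, by decide, by decide,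
        block 0 2 (by decide) h2 (fun j hj0 hj2 ↦ not_or.mp ?_),
        block 1 3 (by decide) h13 (fun j hj1 hj3 ↦ not_or.mp ?_)⟩
      · fin_cases j
        · exact absurd rfl hj0
        · exact h1
        · exact absurd rfl hj2
        · exact h3
      · fin_cases j
        · exact notB 0 1 h1
        · exact absurd rfl hj1
        · exact sep 2 1 h2 h1
        · exact absurd rfl hj3
    · exfalso; refine alone 1 fun j hj ↦ not_or.mp ?_
      fin_cases j
      · exact notB 0 1 h1
      · exact absurd rfl hj
      · exact sep 2 1 h2 h1
      · exact h13
  · by_cases h12 : r 2 = r 1 ∨ r 2 = -r 1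
    · left
      refine ⟨0, 3, 1, 2, by decide, by decide, by decide, by decide, by decide, by decide,
        block 0 3 (by decide) h3 (fun j hj0 hj3 ↦ not_or.mp ?_),
        block 1 2 (by decide) h12 (fun j hj1 hj2 ↦ not_or.mp ?_)⟩
      · fin_cases j
        · exact absurd rfl hj0
        · exact h1
        · exact h2
        · exact absurd rfl hj3
      · fin_cases j
        · exact notB 0 1 h1
        · exact absurd rfl hj1
        · exact absurd rfl hj2
        · exact sep 3 1 h3 h1
    · exfalso; refine alone 1 fun j hj ↦ not_or.mp ?_
      fin_cases j
      · exact notB 0 1 h1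
      · exact absurd rfl hj
      · exact h12
      · exact sep 3 1 h3 h1
  · exfalso; refine alone 0 fun j hj ↦ not_or.mp ?_
    fin_cases j
    · exact absurd rfl hj
    · exact h1
    · exact h2
    · exact h3

/-! ### Free `±`-classes by counting -/

omit [NeZero n] in
/-- If the kernel has at least nine elements, every `±`-class mod `q` of four points is free.
[folklore] -/
theorem exists_free_pm_of_nine_le {d : ℕ} (hd : d ∣ q)
    (hker : 9 ≤ #(univ.filter fun u : (ZMod q)ˣ ↦ ZMod.unitsMap hd u = 1))
    (ρ : Fin 4 → (ZMod q)ˣ) (y : (ZMod q)ˣ) :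
    ∃ u : (ZMod q)ˣ, ZMod.unitsMap hd u = 1 ∧
      ∀ i, (ρ i : ZMod q) ≠ (u : ZMod q) * y ∧ (ρ i : ZMod q) ≠ -((u : ZMod q) * y) := by
  classical
  by_contra hcon
  push Not at hcon
  set g : Fin 4 × Bool → (ZMod q)ˣ := fun ib ↦ if ib.2 then ρ ib.1 * y⁻¹ else -(ρ ib.1 * y⁻¹) with hg
  have hsub : univ.filter (fun u : (ZMod q)ˣ ↦ ZMod.unitsMap hd u = 1) ⊆ univ.image g := by
    intro u hu
    rw [mem_filter] at hu
    obtain ⟨i, hi⟩ := hcon u hu.2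
    rw [mem_image]
    by_cases h1 : (ρ i : ZMod q) = (u : ZMod q) * y
    · refine ⟨(i, true), mem_univ _, ?_⟩
      simp only [hg, if_true]
      rw [mul_inv_eq_iff_eq_mul]
      exact Units.ext (by rw [Units.val_mul]; exact h1)
    · have h2 := hi h1
      refine ⟨(i, false), mem_univ _, ?_⟩
      simp only [hg, Bool.false_eq_true, if_false]
      rw [neg_eq_iff_eq_neg, mul_inv_eq_iff_eq_mul]
      apply Units.ext
      rw [Units.val_mul, Units.val_neg, h2]; ring
  have := Finset.card_le_card hsub
  have h8 : #(univ.image g) ≤ 8 := le_trans Finset.card_image_le (by simp)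
  omega

omit [NeZero n] in
/-- At a prime power `p^e` with `e ≥ 2` (`-1 ∉ ker`, `#ker ≥ 5`): every `±`-class of four points
is free (each point excludes at most one kernel element). [folklore] -/
theorem exists_free_pm_of_neg_one_notMem {d : ℕ} (hd : d ∣ q)
    (hm1 : ZMod.unitsMap hd (-1) ≠ 1)
    (hker : 5 ≤ #(univ.filter fun u : (ZMod q)ˣ ↦ ZMod.unitsMap hd u = 1))
    (ρ : Fin 4 → (ZMod q)ˣ) (y : (ZMod q)ˣ) :
    ∃ u : (ZMod q)ˣ, ZMod.unitsMap hd u = 1 ∧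
      ∀ i, (ρ i : ZMod q) ≠ (u : ZMod q) * y ∧ (ρ i : ZMod q) ≠ -((u : ZMod q) * y) := by
  classical
  by_contra hcon
  push Not at hcon
  set g : Fin 4 → (ZMod q)ˣ := fun i ↦
    if ZMod.unitsMap hd (ρ i * y⁻¹) = 1 then ρ i * y⁻¹ else -(ρ i * y⁻¹) with hg
  have hsub : univ.filter (fun u : (ZMod q)ˣ ↦ ZMod.unitsMap hd u = 1) ⊆ univ.image g := by
    intro u hu
    rw [mem_filter] at hu
    obtain ⟨i, hi⟩ := hcon u hu.2
    rw [mem_image]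
    refine ⟨i, mem_univ _, ?_⟩
    by_cases h1 : (ρ i : ZMod q) = (u : ZMod q) * y
    · have hu' : ρ i * y⁻¹ = u := by
        rw [mul_inv_eq_iff_eq_mul]
        exact Units.ext (by rw [Units.val_mul]; exact h1)
      simp only [hg, hu', hu.2, if_true]
    · have h2 := hi h1
      have hu' : -(ρ i * y⁻¹) = u := by
        rw [neg_eq_iff_eq_neg, mul_inv_eq_iff_eq_mul]
        apply Units.ext
        rw [Units.val_mul, Units.val_neg, h2]; ring
      have hnot : ZMod.unitsMap hd (ρ i * y⁻¹) ≠ 1 := by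
        intro h3
        apply hm1
        have : (-1 : (ZMod q)ˣ) = -(ρ i * y⁻¹) * (ρ i * y⁻¹)⁻¹ := by rw [neg_mul, mul_inv_cancel]
        rw [this, map_mul, map_inv, hu', hu.2, h3, inv_one, one_mul]
      simp only [hg, if_neg hnot, hu']
  have := Finset.card_le_card hsub
  have h4 : #(univ.image g) ≤ 4 := le_trans Finset.card_image_le (by simp)
  omega

/-- **[Aoki1983, Prop. 8.2] at a level with a large prime.** Let `f` be odd or divisible by `4`
with a prime factor `p ≥ 11`, or `p ∈ {5, 7}` with `p² ∣ f`. Four units `xᵢ` with `∑ χ(xᵢ) = 0`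
for all odd primitive `χ` mod `f` SPLIT into two annihilated pairs, or `5 ∥ f` and
`χ(xᵢ mod f/5)` is independent of `i` for every odd primitive `χ` mod `f/5`.
[cite: Aoki1983, Prop. 8.2] -/
theorem quad_odd_level {f : ℕ} [NeZero f] (hval : Odd f ∨ 4 ∣ f) {p : ℕ} (hp : p.Prime)
    (hpf : p ∣ f) (hbig : 11 ≤ p ∨ (5 ≤ p ∧ p ^ 2 ∣ f)) (x : Fin 4 → (ZMod f)ˣ)
    (hT : ∀ χ : DirichletCharacter ℂ f, χ.Odd → χ.IsPrimitive → ∑ i, χ (x i) = 0) :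
    (∃ i j k l : Fin 4, i ≠ j ∧ i ≠ k ∧ i ≠ l ∧ j ≠ k ∧ j ≠ l ∧ k ≠ l ∧
      (∀ χ : DirichletCharacter ℂ f, χ.Odd → χ.IsPrimitive → χ (x i) + χ (x j) = 0) ∧
      (∀ χ : DirichletCharacter ℂ f, χ.Odd → χ.IsPrimitive → χ (x k) + χ (x l) = 0)) ∨
    (∃ f₅ : ℕ, f = 5 * f₅ ∧ ¬ 5 ∣ f₅ ∧ ∀ (hd5 : f₅ ∣ f) (χ : DirichletCharacter ℂ f₅),
      χ.Odd → χ.IsPrimitive → ∀ i j : Fin 4,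
        χ (ZMod.castHom hd5 (ZMod f₅) (x i)) = χ (ZMod.castHom hd5 (ZMod f₅) (x j))) := by
  classical
  have hf0 : f ≠ 0 := NeZero.ne f
  have hp5 : 5 ≤ p := by rcases hbig with h | h <;> omega
  have hp2 : p ≠ 2 := by omega
  have hp3 : p ≠ 3 := by omega
  obtain ⟨e, he⟩ : ∃ e, f.factorization p = e := ⟨_, rfl⟩
  have he1 : 1 ≤ e := he ▸ hp.factorization_pos_of_dvd hf0 hpf
  have hcop0 : Nat.Coprime p (f / p ^ e) := he ▸ Nat.coprime_ordCompl hp hf0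
  have he2 : p ^ 2 ∣ f → 2 ≤ e := fun h2 ↦ he ▸ (hp.pow_dvd_iff_le_factorization hf0).mp h2
  obtain ⟨n, rfl⟩ : ∃ n, f = p ^ e * n :=
    ⟨f / p ^ e, by rw [← he]; exact (Nat.ordProj_mul_ordCompl_eq_self f p).symm⟩
  have hpe0 : p ^ e ≠ 0 := pow_ne_zero e hp.ne_zero
  have hn0 : n ≠ 0 := fun h0 ↦ hf0 (by rw [h0, mul_zero])
  haveI : NeZero n := ⟨hn0⟩
  haveI : NeZero (p ^ e) := ⟨hpe0⟩
  have hdiv : p ^ e * n / p ^ e = n := Nat.mul_div_cancel_left n (Nat.pos_of_ne_zero hpe0)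
  rw [hdiv] at hcop0
  have hcop : (p ^ e).Coprime n := Nat.Coprime.pow_left e hcop0
  have hq1 : 1 < p ^ e := lt_of_lt_of_le hp.one_lt (Nat.le_self_pow (by omega) p)
  haveI : Fact (1 < p ^ e) := ⟨hq1⟩
  have hpodd : Odd p := hp.odd_of_ne_two hp2
  have hqodd : Odd (p ^ e) := hpodd.pow
  have hnval : Odd n ∨ 4 ∣ n := by
    rcases hval with ho | h4
    · exact Or.inl (Nat.Odd.of_mul_right ho)
    · right
      have hc' : Nat.Coprime (2 ^ 2) (p ^ e) :=
        Nat.Coprime.pow 2 e ((Nat.coprime_primes Nat.prime_two hp).mpr (Ne.symm hp2))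
      exact (show Nat.Coprime 4 (p ^ e) by simpa using hc').dvd_of_dvd_mul_left h4
  have hd : p ^ (e - 1) ∣ p ^ e := pow_dvd_pow p (Nat.sub_le e 1)
  have hprim : ∀ χ : DirichletCharacter ℂ (p ^ e), ¬ χ.FactorsThrough (p ^ (e - 1)) →
      χ.IsPrimitive := fun χ hχ ↦ isPrimitive_of_not_factorsThrough_primePow hp he1 χ hχ
  have hq2 : IsUnit (2 : ZMod (p ^ e)) := by
    rw [show (2 : ZMod (p ^ e)) = ((2 : ℕ) : ZMod (p ^ e)) by norm_cast, ZMod.isUnit_iff_coprime]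
    exact Nat.Coprime.pow_right e ((Nat.coprime_primes Nat.prime_two hp).mpr (Ne.symm hp2))
  -- free `±`-classes
  have hfreeAll : ∀ y : (ZMod (p ^ e))ˣ, ∃ u : (ZMod (p ^ e))ˣ, ZMod.unitsMap hd u = 1 ∧
      ∀ i, ZMod.castHom (dvd_mul_right (p ^ e) n) (ZMod (p ^ e)) (x i) ≠ (u : ZMod (p ^ e)) * y ∧
        ZMod.castHom (dvd_mul_right (p ^ e) n) (ZMod (p ^ e)) (x i) ≠ -((u : ZMod (p ^ e)) * y) := by
    intro y
    have key : ∃ u : (ZMod (p ^ e))ˣ, ZMod.unitsMap hd u = 1 ∧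
        ∀ i, ((ZMod.unitsMap (dvd_mul_right (p ^ e) n) (x i) : (ZMod (p ^ e))ˣ) : ZMod (p ^ e)) ≠
          (u : ZMod (p ^ e)) * y ∧
          ((ZMod.unitsMap (dvd_mul_right (p ^ e) n) (x i) : (ZMod (p ^ e))ˣ) : ZMod (p ^ e)) ≠
          -((u : ZMod (p ^ e)) * y) := by
      rcases Nat.lt_or_ge e 2 with he2' | he2'
      · -- `e = 1`, `p ≥ 11`: the kernel is everything, `#ker = p - 1 ≥ 10`
        have he1' : e = 1 := by omega
        subst he1'
        have hp11 : 11 ≤ p := by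
          rcases hbig with h | ⟨-, h⟩
          · exact h
          · have := he2 h; omega
        refine exists_free_pm_of_nine_le hd ?_ _ y
        rw [Finset.filter_true_of_mem (fun u _ ↦ unitsMap_eq_one_of_eq_one _ (by simp) u),
          Finset.card_univ, ZMod.card_units_eq_totient, pow_one, Nat.totient_prime hp]
        omega
      · refine exists_free_pm_of_neg_one_notMem hd
          (unitsMap_neg_one_ne_one hd (lt_of_lt_of_le (by omega : 2 < p)
            (Nat.le_self_pow (by omega) p))) ?_ _ y
        rw [card_ker_primePow hp he2']
        exact hp5
    obtain ⟨u, hu, hfu⟩ := key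
    exact ⟨u, hu, fun i ↦ by rw [← coe_unitsMap]; exact hfu i⟩
  rcases quad_odd_top hcop hd hprim hq2 hnval x hT hfreeAll with hsplit | ⟨n₅, hn5, h5, H⟩
  · exact Or.inl hsplit
  · right
    have hp5' : p ≠ 5 := by
      rintro rfl
      exact absurd (dvd_trans ⟨n₅, hn5⟩ (dvd_refl n) : 5 ∣ n)
        ((Nat.Prime.coprime_iff_not_dvd Nat.prime_five).mp
          (Nat.Coprime.coprime_dvd_left (dvd_pow_self 5 (by omega)) hcop))
    refine ⟨p ^ e * n₅, by rw [hn5]; ring, fun h5' ↦ ?_, fun hd5 χ hodd hχ i j ↦ H hd5 χ hodd hχ i j⟩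
    rcases (Nat.Prime.dvd_mul Nat.prime_five).mp h5' with h' | h'
    · exact hp5' ((Nat.prime_dvd_prime_iff_eq Nat.prime_five hp).mp
        (Nat.Prime.dvd_of_dvd_pow Nat.prime_five h')).symm
    · exact h5 h'

end Top

end FermatCharacter

end Literature.AlgebraicGeometry.HodgeTheory
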